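import Summits.QuantumFields.YangMills.Theorems.BalabanUVNodesN15KingModelEuclideanDecay
import Summits.QuantumFields.YangMills.Theorems.BalabanUVNodesN15KingModelTwoPointInfiniteVolumeDecay

/-!
# BalabanUVNodes ∕ N15 — THE KING-MODEL RUNG (PART Ϻ-h): EXPONENTIAL MOMENTS OF KING's CONTINUUM BLOCK TWO-POINT FUNCTION UP TO THE MASS —
# `Σ_{z∈ℤ^{d+1}} S₂^{ℝ}(z)·e^{b‖z‖₂} < ∞` for every `b < m`, `Σ_z S₂^{ℝ}(z)e^{a·z} < ∞` for every `‖a‖₂ < m`, and all polynomial moments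
# (Track A, DAG node N15 = NE2; FAN-OUT v1.1 §N15 s3 «KING-MODEL RUNG»; uses parts Ϻ-b∕Ϻ-d and Ϝ-k's lattice-sum majorant; count-neutral)

HONEST FRAMING.  Count-neutral (cell `pub-ymgap`, seat `pub-ymgap-dag-n15-e` g35; `--supports stmt-QuantumFields-27366 --as helper` = K3⁸).  King's `A = 0`, `g = 0` model
([King1986] C. King, Commun. Math. Phys. **102** (1986) 649–677).  Part Ϝ-k proved `Σ_z S₂^{ℝ}(z) = m⁻²` (summability at rate `0`); part Ϻ-d proved the Euclidean
clustering `S₂^{ℝ}(z) ≤ K_ε e^{−(1−ε)m‖z‖₂}` for every `ε ∈ (0,1]`.  THIS FILE draws the summability consequences (door (t4³⁵)): for every `b < m` the EXPONENTIAL MOMENT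
`Σ_z S₂^{ℝ}(z)e^{b‖z‖₂}` is finite (choose `ε` with `(1−ε)m > b`; `e^{−c‖z‖₂} ≤ Π_ν e^{−(c∕(d+1))|z_ν|}` is summable over `ℤ^{d+1}` by part Ϝ-k's box majorant); hence
`Σ_z S₂^{ℝ}(z)e^{a·z} < ∞` for every `a ∈ ℝ^{d+1}` with `‖a‖₂ < m` (Cauchy–Schwarz) — the lattice Laplace transform of `S₂^{ℝ}` is finite on the open Euclidean ball of
radius `m` (equivalently, its Fourier series converges absolutely for complex momenta with `‖Im p‖₂ < m`; the holomorphy statement itself is not typed here) — and every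
polynomial moment `Σ_z ‖z‖₂^k S₂^{ℝ}(z)` is finite.  The radius `m` is sharp by part Ϻ-d's lower bound (not restated).  NOT Bałaban's objects; NOT a node discharge; nothing
continuum-Yang–Mills ∕ `ℝ⁴` ∕ OS ∕ Clay.  0 `sorry`, 0 def; standard axioms.

WHAT THIS FILE PROVES (kernel).  §1 `abs_le_euclidNorm`, `exp_neg_mul_norm_le_prod`, ★ `summable_exp_neg_mul_norm` (`Σ_z e^{−c‖z‖₂} < ∞`, `c > 0`).  §2 ★★★ **`summable_kingS2Inf_mul_exp_norm`**
(`b < √m²`), ★★ **`summable_kingS2Inf_mul_exp_dot`** (`‖a‖₂ < √m²`), ★★ `summable_kingS2Inf_mul_norm_pow` (all `k`), `tsum_kingS2Inf_mul_exp_norm_pos`.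

HONEST SCOPE.  King's free model, `m² > 0`, every `d`.  N15 untouched; counts unmoved.  Locators (use): [King1986] Thm 2.1 (2.22)–(2.23) p.654, Thm 3.3 (3.6) p.655, (4.5) p.670.
-/

noncomputable section

open scoped BigOperators Topology
open Filter MeasureTheory Set Function

namespace Summit.QuantumFields.YangMills.BalabanUVNodes.N15KingModelRung.ProperTime

open Summit.QuantumFields.YangMills.BalabanUVNodes.N15KingModelRung.OptimalDecay

variable {d : ℕ}

/-! ## §1 `Σ_{z∈ℤ^{d+1}} e^{−c‖z‖₂} < ∞` -/

/-- `|z_ν| ≤ ‖z‖₂`. [folklore] -/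
theorem abs_le_euclidNorm (z : Fin (d + 1) → ℤ) (ν : Fin (d + 1)) : |(z ν : ℝ)| ≤ ‖WithLp.toLp 2 (fun μ => (z μ : ℝ))‖ := by
  rw [euclidNorm_eq, ← Real.sqrt_sq (abs_nonneg (z ν : ℝ)), sq_abs]
  exact Real.sqrt_le_sqrt (Finset.single_le_sum (f := fun μ => ((z μ : ℝ)) ^ 2) (fun μ _ => sq_nonneg _) (Finset.mem_univ ν))

/-- `e^{−c‖z‖₂} ≤ Π_ν e^{−(c∕(d+1))|z_ν|}` (`c ≥ 0`). [folklore] -/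
theorem exp_neg_mul_norm_le_prod {c : ℝ} (hc : 0 ≤ c) (z : Fin (d + 1) → ℤ) :
    Real.exp (-(c * ‖WithLp.toLp 2 (fun μ => (z μ : ℝ))‖)) ≤ ∏ ν, Real.exp (-(c / (d + 1 : ℕ) * |(z ν : ℝ)|)) :=
  exp_neg_le_prod_of_forall_le hc (abs_le_euclidNorm z)

/-- ★ `Σ_{z∈ℤ^{d+1}} e^{−c‖z‖₂} < ∞` for `c > 0`. [folklore] -/
theorem summable_exp_neg_mul_norm {c : ℝ} (hc : 0 < c) : Summable fun z : Fin (d + 1) → ℤ => Real.exp (-(c * ‖WithLp.toLp 2 (fun μ => (z μ : ℝ))‖)) := by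
  refine (summable_prod_exp_neg_abs (n := d + 1) (c := c / (d + 1 : ℕ)) (by positivity)).of_nonneg_of_le (fun z => (Real.exp_pos _).le) fun z => ?_
  exact exp_neg_mul_norm_le_prod hc.le z

/-! ## §2 Exponential and polynomial moments of `S₂^{ℝ}` -/

/-- ★★★ **EXPONENTIAL MOMENTS UP TO THE MASS**: for every `b < √m²`, `Σ_{z∈ℤ^{d+1}} S₂^{ℝ}(z)·e^{b‖z‖₂} < ∞`.
[cite: King1986, Thm 3.3 (3.6) p.655, Thm 2.1 (2.22)–(2.23) p.654] -/
theorem summable_kingS2Inf_mul_exp_norm {m2 b : ℝ} (hm : 0 < m2) (hb : b < Real.sqrt m2) :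
    Summable fun z : Fin (d + 1) → ℤ => kingS2Inf m2 z * Real.exp (b * ‖WithLp.toLp 2 (fun μ => (z μ : ℝ))‖) := by
  set m : ℝ := Real.sqrt m2 with hmdef
  have hm' : 0 < m := Real.sqrt_pos.mpr hm
  -- choose `ε ∈ (0,1]` with `(1−ε)m > b`
  set ε : ℝ := min 1 ((m - b) / (2 * m)) with hε
  have hmb : 0 < m - b := by linarith
  have hε0 : 0 < ε := lt_min one_pos (div_pos hmb (by positivity))
  have hε1 : ε ≤ 1 := min_le_left _ _
  have hc : 0 < (1 - ε) * m - b := by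
    rcases le_or_gt ((m - b) / (2 * m)) 1 with h | h
    · have hεeq : ε = (m - b) / (2 * m) := min_eq_right h
      have : ε * m = (m - b) / 2 := by rw [hεeq]; field_simp
      nlinarith
    · have hεeq : ε = 1 := min_eq_left h.le
      rw [hεeq]
      have : 2 * m < m - b := by rwa [lt_div_iff₀ (by positivity), one_mul] at h
      linarith
  set c : ℝ := (1 - ε) * m - b with hcdef
  set K : ℝ := Real.exp ((1 - ε) * m * (1 + Real.sqrt (d + 1))) * (freePropRadial d (ε * m2) (Real.sqrt ε) + m2⁻¹) with hK
  refine ((summable_exp_neg_mul_norm hc).mul_left K).of_norm_bounded fun z => ?_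
  set N : ℝ := ‖WithLp.toLp 2 (fun μ => (z μ : ℝ))‖ with hN
  have hS := kingS2Inf_le_const_mul_exp_neg_norm hm hε0 hε1 z
  rw [← hN] at hS
  rw [Real.norm_eq_abs, abs_of_nonneg (mul_nonneg (kingS2Inf_pos hm z).le (Real.exp_nonneg _))]
  calc kingS2Inf m2 z * Real.exp (b * N) ≤ K * Real.exp (-((1 - ε) * m * N)) * Real.exp (b * N) := mul_le_mul_of_nonneg_right hS (Real.exp_nonneg _)
    _ = K * Real.exp (-(c * N)) := by rw [mul_assoc, ← Real.exp_add]; congr 2; rw [hcdef]; ring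

/-- ★★ **THE LATTICE LAPLACE TRANSFORM IS FINITE ON THE OPEN BALL OF RADIUS `m`**: for `a ∈ ℝ^{d+1}` with `‖a‖₂ < √m²`, `Σ_z S₂^{ℝ}(z)e^{a·z} < ∞` (Cauchy–Schwarz
`a·z ≤ ‖a‖₂‖z‖₂`). [cite: King1986, Thm 3.3 (3.6) p.655, Thm 2.1 (2.22) p.654] -/
theorem summable_kingS2Inf_mul_exp_dot {m2 : ℝ} (hm : 0 < m2) {a : Fin (d + 1) → ℝ} (ha : ‖WithLp.toLp 2 a‖ < Real.sqrt m2) :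
    Summable fun z : Fin (d + 1) → ℤ => kingS2Inf m2 z * Real.exp (∑ μ, a μ * z μ) := by
  refine (summable_kingS2Inf_mul_exp_norm hm ha).of_nonneg_of_le (fun z => mul_nonneg (kingS2Inf_pos hm z).le (Real.exp_nonneg _)) fun z => ?_
  refine mul_le_mul_of_nonneg_left (Real.exp_le_exp.mpr ?_) (kingS2Inf_pos hm z).le
  have h := Real.sum_mul_le_sqrt_mul_sqrt Finset.univ a (fun μ => (z μ : ℝ))
  rwa [← euclidNorm_eq, ← euclidNorm_eq] at h

/-- ★★ **ALL POLYNOMIAL MOMENTS**: `Σ_z ‖z‖₂^k·S₂^{ℝ}(z) < ∞` for every `k`. [cite: King1986, Thm 3.3 (3.6) p.655, Thm 2.1 (2.22) p.654] -/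
theorem summable_kingS2Inf_mul_norm_pow {m2 : ℝ} (hm : 0 < m2) (k : ℕ) :
    Summable fun z : Fin (d + 1) → ℤ => kingS2Inf m2 z * ‖WithLp.toLp 2 (fun μ => (z μ : ℝ))‖ ^ k := by
  set m : ℝ := Real.sqrt m2 with hmdef
  have hm' : 0 < m := Real.sqrt_pos.mpr hm
  set b : ℝ := m / 2 with hb
  have hb0 : 0 < b := by positivity
  have hbm : b < m := by rw [hb]; linarith
  -- `N^k ≤ k!·b^{−k}·e^{bN}`
  refine ((summable_kingS2Inf_mul_exp_norm hm hbm).mul_left ((k.factorial : ℝ) / b ^ k)).of_nonneg_of_le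
    (fun z => mul_nonneg (kingS2Inf_pos hm z).le (pow_nonneg (norm_nonneg _) _)) fun z => ?_
  set N : ℝ := ‖WithLp.toLp 2 (fun μ => (z μ : ℝ))‖ with hN
  have hN0 : 0 ≤ N := norm_nonneg _
  have hfac : 0 < (k.factorial : ℝ) := by exact_mod_cast Nat.factorial_pos k
  have hpow : N ^ k ≤ (k.factorial : ℝ) / b ^ k * Real.exp (b * N) := by
    have h := Real.pow_div_factorial_le_exp (b * N) (mul_nonneg hb0.le hN0) k
    rw [mul_pow, div_le_iff₀ hfac] at h
    rw [div_mul_eq_mul_div, le_div_iff₀ (pow_pos hb0 k)]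
    linarith
  calc kingS2Inf m2 z * N ^ k ≤ kingS2Inf m2 z * ((k.factorial : ℝ) / b ^ k * Real.exp (b * N)) := mul_le_mul_of_nonneg_left hpow (kingS2Inf_pos hm z).le
    _ = (k.factorial : ℝ) / b ^ k * (kingS2Inf m2 z * Real.exp (b * N)) := by ring

/-- The exponential moment is positive (every term is). [folklore] -/
theorem tsum_kingS2Inf_mul_exp_norm_pos {m2 b : ℝ} (hm : 0 < m2) (hb : b < Real.sqrt m2) :
    0 < ∑' z : Fin (d + 1) → ℤ, kingS2Inf m2 z * Real.exp (b * ‖WithLp.toLp 2 (fun μ => (z μ : ℝ))‖) := by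
  have hnn : ∀ z : Fin (d + 1) → ℤ, 0 ≤ kingS2Inf m2 z * Real.exp (b * ‖WithLp.toLp 2 (fun μ => (z μ : ℝ))‖) := fun z =>
    mul_nonneg (kingS2Inf_pos hm z).le (Real.exp_nonneg _)
  refine lt_of_lt_of_le (mul_pos (kingS2Inf_pos hm (0 : Fin (d + 1) → ℤ)) (Real.exp_pos (b * ‖WithLp.toLp 2 (fun μ => (((0 : Fin (d + 1) → ℤ) μ : ℤ) : ℝ))‖))) ?_
  exact (summable_kingS2Inf_mul_exp_norm hm hb).le_tsum (0 : Fin (d + 1) → ℤ) fun z _ => hnn z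

end Summit.QuantumFields.YangMills.BalabanUVNodes.N15KingModelRung.ProperTime
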